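import Mathlib.Data.ZMod.Basic
import Mathlib.Tactic
import HarnessLib

/-!
# O5b / T36 — Kobayashi's formal group under tame Kummer descent, I: the Kummer-class ALTERNATION and the LEVEL LAWS
(cell `b2b-bsdres`, lane CLASS-CLOSURE §3.5 O5, team o5; planner o5-r1 GEN 19 — memo `HOME/b2b-bsdres-o5-r1/gen19/T36-KUMMER-DESCENT.md`,
 preregs `gen18/t35/PREREG-K8.md`, `gen19/t36/PREREG-K11.md`; typer of record cc-typer-5 GEN 15, docket (c24); first of three
 siblings (`O5/T36KummerAlternation.lean` = o5-r1's sections (1)–(2); `O5/T36KummerDescentChain.lean` = (3)–(3b);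
 `O5/T36KummerDescentRecords.lean` = (3c)–(4)); placed next to `O5/T34LocalModule.lean` / `O5/O5LocalLattice.lean` (T33–T35), no append;
 namespace `Summit.BirchSwinnertonDyer.Rank1Residual.O5.T36` as in the source; 0 Literature facts.)

HONEST FRAMING (cell `b2b-bsdres`, run/shared/lean/b2b/bsd-rank1-residual/, verbatim in every file): the goal of the cell is
to DELETE the COMBINATION-SHAPED residual classes of the Birch–Swinnerton-Dyer formula for ALL analytic-rank `≤ 1` elliptic
curves over `ℚ` — "full BSD formula for every rank `≤ 1` curve in class `C`" assembled STRICTLY from published theorems — so that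
the rank-`≤ 1` remainder becomes exactly the CONSTRUCTION-SHAPED classes, which are TYPED (missing-input `Prop`s), NOT attempted.
This is not "finishing BSD". Lane CLASS-CLOSURE / team o5: research routes; census output is EVIDENCE / conjecture items, never a
Literature fact; no main conjecture inside any certificate; nothing is booked; no mark of `RESIDUAL-MAP.md` moves; O5 stays OPEN.

WHAT THIS FILE TYPES (o5-r1's words).
(1) `KummerAlternation`: the elementary fact behind PREREG-K11 — in `ZMod 4`, `3 ^ n` is `1` for even `n` and `3` for odd `n`, so the
    Kummer-graded piece `a ↦ a * 3 ^ n` fixes the classes `0, 2` and SWAPS `1, 3` at odd levels (the III line and the III* line exchange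
    their level-intrinsic Kummer valuation class; equivalently `v(Δ_W) = 3·3^n` is `3 mod 12` for even `n`, `9 mod 12` for odd `n`:
    type III / III* alternate up the cyclotomic tower).
(2) `Laws`: the competing level-laws for the cyclotomic-line defect sequences `κA` (III line) and `κB` (III* line) as `Prop`s on
    abstract sequences `ℕ → ℕ` — `LawS` (valuation-class law: alternating, bounded), `LawGb` (character law, bounded), `LawGu` (growing) —
    with the book-keeping theorems: all three agree with the MEASURED prefix `n ≤ 4`, `S` and `Gb` are bounded, `Gu` is not, and level 5
    separates `S` from `Gb`/`Gu` (the content of the deciders K8-1 / K8-3 / K11-3 / K11-4); the measured level-5 pair `(2, 2)` KILLS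
    S / G-b / G-u (`level5_kills_S_Gb_Gu`) and selects the post-hoc LAW P (`LawP`, PREREG-K13 for level 6; consistent: `lawP_realised`).

TYPING DISCIPLINE (cc-lead GEN 59 (c24), OWNERS l.758 (α)–(ε); o5-r1 GEN 19 A-O5-42, requests l.2867, `b2b-bsdres-o5-r1/gen19/HANDOFF.md`
l.56; census-lead G-33 'yours to route'): (α) measured records are `def` DATA with EVIDENCE docstrings (engine KDELTA `signed_job5.py`
a050b8c5df153fd9; kit j156361 / j158099 / j158102 / j158187 / j159305 / j159507 / j159568 / j159741 / j159795; census-lead G-33: K11a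
one-implementation EVIDENCE REPRODUCED from raw, K11-1 / V11-c HIT as registered, sheet reading U on the 3 β rows; O5 OPEN; not a
Literature fact); (β) laws are `def … : Prop` over ABSTRACT profiles `ℕ → ℕ` / the interface `CycLine`, and the lemmas are pure
`decide` / `omega` arithmetic; (γ) NO declaration asserts a law for a curve — the dead laws S / G-b / G-u / 'α never' / T36-BD(d ≤ 2)
appear only through their incompatibility / refutation lemmas, the standing targets (law P′ `T36_P5`, `T36_BD4`, C-T36-3‴, C-T36-4′)
only as `Prop`-valued definitions labelled with o5-r1's PREREG ids and 'decided at LEVEL 6, GEN 20+' (no `@[conjecture]` node is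
minted: the conjecture "the census curves realise law P′" has no curve-level decl here by (γ), so there is no closed `Prop` to tag);
(δ) `T36Chain.Assembly` is an abstract schema with displayed binders, imported into NO CLASS END; (ε) 0 facts, zero kit by the typer,
one proposal in flight.  The typer's only edits to o5-r1's bytes (source `b2b-bsdres-o5-r1/gen19/T36KummerDescent.lean` sha16
`8a38a4e385d5af39`, 564 l., `lean check` rc 0 on the farm as is): the split into three sibling files (`lint.size`), the module
docstrings, and ONE-LINE docstrings on the declarations that had none (`lint.docstring`); every declaration body is byte-identical.
NOT the typer's (cc-lead GEN 59): A-O5-41 (o5-r1 GEN 20's scoring) and A-O5-43 (explicit f / distance law / N-T36-3 SD₁₆ / Q₈ group lemma).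

DEDUP (`lean search`): `T36KummerAlternation`, `LawS`, `LawP`, `MatchesPrefix` — no match in `…O5`; `kummerExp` exists only as
`Literature.AlgebraicGeometry.Resolution.KummerCone.kummerExp` (unrelated, different FQN).
References: [Kobayashi2003] S. Kobayashi, Invent. Math. 152 (2003) §8; [KitajimaOtsuki] arXiv:1607.03612 Prop 3.16; [Kim2013] J. Aust.
Math. Soc. 95 (k/ℚ_p unramified only, p. 3); [BKO2021] Ann. Math. 194; [YanZhu2024] arXiv:2401.09037; [SchneiderVenjakob]
arXiv:1511.04922; [BergerFourquaux] arXiv:1512.03383; [Sprung2012] JNT 132; [Delbourgo1998] Compositio 113.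
-/

set_option autoImplicit false

namespace Summit.BirchSwinnertonDyer.Rank1Residual.O5.T36

/-! ## (1) Kummer-class alternation -/
section KummerAlternation

/-- `c_n = 3^n mod 4`: the exponent relating the curve's Kummer generator `λ` (`λ⁴ = −3`) to the level-intrinsic one `μ_n` (`μ_n⁴ = unit·π_n`). -/
def kummerExp (n : ℕ) : ZMod 4 := 3 ^ n

/-- `3² = 1` in `ℤ/4`. Elementary. [folklore] -/
theorem three_sq_zmod4 : (3 : ZMod 4) ^ 2 = 1 := by decide

/-- At even levels the Kummer exponent class is `1`. Elementary. [folklore] -/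
theorem kummerExp_even (k : ℕ) : kummerExp (2 * k) = 1 := by
  unfold kummerExp; rw [pow_mul, three_sq_zmod4, one_pow]

/-- At odd levels the Kummer exponent class is `3`. Elementary. [folklore] -/
theorem kummerExp_odd (k : ℕ) : kummerExp (2 * k + 1) = 3 := by
  unfold kummerExp; rw [pow_succ, pow_mul, three_sq_zmod4, one_pow, one_mul]

/-- the level-`n` Kummer valuation class of the curve piece `a` (`a = 1`: III line `A`, `a = 3`: III* line `B`, `0`: good `A₀`, `2`: `B₀`). -/
def pieceClass (a : ZMod 4) (n : ℕ) : ZMod 4 := a * kummerExp n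

/-- Even levels fix every Kummer valuation class. Elementary. [folklore] -/
theorem pieceClass_even (a : ZMod 4) (k : ℕ) : pieceClass a (2 * k) = a := by
  simp [pieceClass, kummerExp_even]

/-- Odd levels swap the classes `1 ↔ 3` (III line ↔ III* line) and fix `0`, `2`. Elementary. [folklore] -/
theorem pieceClass_odd_swaps (k : ℕ) :
    pieceClass 1 (2 * k + 1) = 3 ∧ pieceClass 3 (2 * k + 1) = 1 ∧ pieceClass 0 (2 * k + 1) = 0 ∧ pieceClass 2 (2 * k + 1) = 2 := by
  refine ⟨?_, ?_, ?_, ?_⟩ <;> simp [pieceClass, kummerExp_odd] <;> decide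

/-- Kodaira alternation: `v(Δ_W ⊗ ℚ_{3,n}) = 3·3^n` is `3 (mod 12)` (type III) at even levels and `9 (mod 12)` (type III*) at odd levels. -/
theorem discVal_mod12 : ∀ n ∈ List.range 12, (3 * 3 ^ n) % 12 = if n % 2 = 0 then 3 else 9 := by decide

end KummerAlternation

/-! ## (2) Level laws for the defect sequences on the III line (`κA`) and the III* line (`κB`) -/
section Laws

/-- A defect sequence `κ : ℕ → ℕ` is bounded. Bookkeeping. [folklore] -/
def Bounded (κ : ℕ → ℕ) : Prop := ∃ d, ∀ n, κ n ≤ d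

/-- measured prefix [meas: j155923, j156492/494/498 (n = 4, all 44 reps); levels ≤ 3 local]: III-β line `0,0,0,0,2`, III*-β line `0,0,0,0,0` (n = 0..4). -/
def measA : List ℕ := [0, 0, 0, 0, 2]
/-- measured prefix of the III*-β line, `0,0,0,0,0` (n = 0..4) [meas: as `measA`]. -/
def measB : List ℕ := [0, 0, 0, 0, 0]

/-- A pair of defect sequences agrees with the MEASURED prefix `n ≤ 4` (`measA`, `measB`). Bookkeeping predicate; nothing asserted for a curve. [folklore] -/
def MatchesPrefix (κA κB : ℕ → ℕ) : Prop := ∀ n, n ≤ 4 → κA n = measA.getD n 0 ∧ κB n = measB.getD n 0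

/-- (S) valuation-class law: the `(ℤ/3)²` alternates between the III line (even `n ≥ 4`) and the III* line (odd `n ≥ 5`). -/
def LawS (κA κB : ℕ → ℕ) : Prop :=
  MatchesPrefix κA κB ∧ ∀ n, 4 ≤ n → (n % 2 = 0 → κA n = 2 ∧ κB n = 0) ∧ (n % 2 = 1 → κA n = 0 ∧ κB n = 2)

/-- (G-b) character law, bounded: the defect stays on the III line, value 2, III* line exact. -/
def LawGb (κA κB : ℕ → ℕ) : Prop := MatchesPrefix κA κB ∧ ∀ n, 4 ≤ n → κA n = 2 ∧ κB n = 0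

/-- (G-u) character law, growing (the `a_p ≠ 0` / Sprung-like regime): strictly increasing on the III line from level 4. -/
def LawGu (κA κB : ℕ → ℕ) : Prop := MatchesPrefix κA κB ∧ ∀ n, 4 ≤ n → κA n < κA (n + 1) ∧ κB n = 0

/-- Law S is bounded on both lines (bound `2`). Pure arithmetic on abstract sequences. [folklore] -/
theorem lawS_bounded {κA κB : ℕ → ℕ} (h : LawS κA κB) : Bounded κA ∧ Bounded κB := by
  obtain ⟨hp, hs⟩ := h
  refine ⟨⟨2, fun n => ?_⟩, ⟨2, fun n => ?_⟩⟩
  · by_cases hn : 4 ≤ n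
    · obtain ⟨he, ho⟩ := hs n hn
      rcases Nat.mod_two_eq_zero_or_one n with h0 | h1
      · rw [(he h0).1]
      · rw [(ho h1).1]; decide
    · have hn := Nat.lt_of_not_le hn
      have := (hp n (by omega)).1
      interval_cases n <;> simp_all [measA]
  · by_cases hn : 4 ≤ n
    · obtain ⟨he, ho⟩ := hs n hn
      rcases Nat.mod_two_eq_zero_or_one n with h0 | h1
      · rw [(he h0).2]; decide
      · rw [(ho h1).2]
    · have hn := Nat.lt_of_not_le hn
      have := (hp n (by omega)).2
      interval_cases n <;> simp_all [measB]

/-- Law G-b is bounded on the III line. Pure arithmetic. [folklore] -/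
theorem lawGb_bounded {κA κB : ℕ → ℕ} (h : LawGb κA κB) : Bounded κA := by
  obtain ⟨hp, hs⟩ := h
  refine ⟨2, fun n => ?_⟩
  by_cases hn : 4 ≤ n
  · rw [(hs n hn).1]
  · have hn := Nat.lt_of_not_le hn
    have := (hp n (by omega)).1
    interval_cases n <;> simp_all [measA]

/-- Under law G-u the III-line defect grows at least linearly from level 4: `κA(4+k) ≥ 2+k`. Pure arithmetic. [folklore] -/
theorem lawGu_growth {κA κB : ℕ → ℕ} (h : LawGu κA κB) : ∀ k, κA (4 + k) ≥ 2 + k := by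
  obtain ⟨hp, hs⟩ := h
  intro k
  induction k with
  | zero =>
    have h4 := (hp 4 le_rfl).1
    norm_num [measA] at h4 ⊢
    omega
  | succ k ih =>
    have hlt := (hs (4 + k) (by omega)).1
    rw [show 4 + (k + 1) = 4 + k + 1 by omega]
    omega

/-- Law G-u is unbounded on the III line. Pure arithmetic. [folklore] -/
theorem lawGu_unbounded {κA κB : ℕ → ℕ} (h : LawGu κA κB) : ¬ Bounded κA := by
  rintro ⟨d, hd⟩
  have h1 := lawGu_growth h d
  have h2 := hd (4 + d)
  omega

/-- Level 5 separates S from the character laws: K8-1 / K11-4 (`κA 5`) is `0` under S and `≥ 2` under G; K8-3 / K11-3 (`κB 5`) is `2` under S, `0` under G. -/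
theorem level5_separates {κA κB : ℕ → ℕ} : LawS κA κB → (κA 5 = 0 ∧ κB 5 = 2) := by
  rintro ⟨_, hs⟩; exact (hs 5 (by omega)).2 rfl

/-- Level 5 under law G-b: `(κA 5, κB 5) = (2, 0)`. Pure arithmetic. [folklore] -/
theorem level5_separates' {κA κB : ℕ → ℕ} : LawGb κA κB → (κA 5 = 2 ∧ κB 5 = 0) := by
  rintro ⟨_, hs⟩; exact hs 5 (by omega)

/-- Laws S and G-b are incompatible (they disagree at level 5 on the III line). Pure arithmetic. [folklore] -/
theorem S_and_Gb_incompatible {κA κB : ℕ → ℕ} : LawS κA κB → LawGb κA κB → False := by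
  intro hS hG
  have h1 := (level5_separates hS).1
  have h2 := (level5_separates' hG).1
  omega

/-- the reading sheet of PREREG-K11 as a function of the two level-5 numbers (K8-1, K8-3). -/
inductive Reading | S | Gb | Gu | T | U
  deriving DecidableEq, Repr

/-- the PREREG-K11 reading as a function of the two level-5 numbers `(κA 5, κB 5)` (`kA5 = 1` is outside all forecasts; recorded as Gb-anomalous by convention). Bookkeeping. [folklore] -/
def readLevel5 (kA5 kB5 : ℕ) : Reading :=
  if kA5 = 0 ∧ kB5 = 0 then .T
  else if kA5 = 0 then .S
  else if kB5 = 0 then (if kA5 = 2 then .Gb else .Gu)   -- kA5 = 1 is outside all forecasts; recorded as Gb-anomalous by convention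
  else .U

/-- The reading sheet on the five forecast pairs. By `decide`. [folklore] -/
theorem readLevel5_table :
    readLevel5 0 2 = .S ∧ readLevel5 2 0 = .Gb ∧ readLevel5 3 0 = .Gu ∧ readLevel5 0 0 = .T ∧ readLevel5 2 2 = .U := by decide

/-! ### Level 5 measured (j156361, 2026-08-22T09:49Z): 3150f1 = (κ_Δ(A), κ_s(B) ‖ κ_Δ(B), κ_s(A)) = (2, 4 ‖ 2, 3). [meas] -/
/-- Level 5 MEASURED record of the III-β row `3150f1`: `(κ_Δ(A), κ_s(B), κ_Δ(B), κ_s(A)) = (2, 4, 2, 3)` — data, EVIDENCE [meas: kit j156361, 2026-08-22T09:49Z; census-lead G-33 reproduced]. -/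
def k8_3150f1_n5 : ℕ × ℕ × ℕ × ℕ := (2, 4, 2, 3)

/-- The measured level-5 record of `3150f1` reads `U` on the PREREG-K11 sheet (census: sheet reading U). By `decide` on the recorded numbers. [meas: kit j156361] -/
theorem level5_reading_is_U : readLevel5 k8_3150f1_n5.1 k8_3150f1_n5.2.2.1 = .U := by decide

/-- the level-5 pair (2, 2) refutes S, G-b and G-u as laws (each forces a 0 at level 5 on one line). -/
theorem level5_kills_S_Gb_Gu {κA κB : ℕ → ℕ} (hA : κA 5 = 2) (hB : κB 5 = 2) :
    ¬ LawS κA κB ∧ ¬ LawGb κA κB ∧ ¬ LawGu κA κB := by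
  refine ⟨fun h => ?_, fun h => ?_, fun h => ?_⟩
  · have := ((h.2 5 (by norm_num)).2 (by norm_num)).1; omega
  · have := (h.2 5 (by norm_num)).2; omega
  · have := (h.2 5 (by norm_num)).2; omega

/-- LAW P ('S + persistence', post hoc at level 5, PREREG-K13 for level 6): the III line carries `(ℤ/3)²` from level 4 on,
the III* line from level 5 on (its first type-III level ≥ 4), both persist without growth. [conj] -/
def LawP (κA κB : ℕ → ℕ) : Prop :=
  MatchesPrefix κA κB ∧ (∀ n, 4 ≤ n → κA n = 2) ∧ (∀ n, 5 ≤ n → κB n = 2)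

/-- Law P at level 5: `(2, 2)`. Pure arithmetic. [folklore] -/
theorem lawP_level5 {κA κB : ℕ → ℕ} (h : LawP κA κB) : κA 5 = 2 ∧ κB 5 = 2 :=
  ⟨h.2.1 5 (by norm_num), h.2.2 5 (by norm_num)⟩

/-- Law P's level-6 FORECAST `(2, 2)` (PREREG-K13; decided at LEVEL 6, o5-r1 GEN 20+). Pure arithmetic on the law, nothing asserted for a curve. [folklore] -/
theorem lawP_level6_forecast {κA κB : ℕ → ℕ} (h : LawP κA κB) : κA 6 = 2 ∧ κB 6 = 2 :=
  ⟨h.2.1 6 (by norm_num), h.2.2 6 (by norm_num)⟩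

/-- Law P is bounded on both lines (bound `2`). Pure arithmetic. [folklore] -/
theorem lawP_bounded {κA κB : ℕ → ℕ} (h : LawP κA κB) : Bounded κA ∧ Bounded κB := by
  obtain ⟨hp, hA, hB⟩ := h
  refine ⟨⟨2, fun n => ?_⟩, ⟨2, fun n => ?_⟩⟩
  · by_cases h4 : 4 ≤ n
    · rw [hA n h4]
    · have := (hp n (by omega)).1
      rw [this]; interval_cases n <;> simp [measA]
  · by_cases h5 : 5 ≤ n
    · rw [hB n h5]
    · have := (hp n (by omega)).2
      rw [this]; interval_cases n <;> simp [measB]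

/-- a witness that LawP is consistent (the step functions). -/
theorem lawP_realised : LawP (fun n => if 4 ≤ n then 2 else 0) (fun n => if 5 ≤ n then 2 else 0) := by
  refine ⟨?_, ?_, ?_⟩
  · intro n hn
    interval_cases n <;> simp [measA, measB]
  · intro n hn; simp [hn]
  · intro n hn; simp [hn]

end Laws

end Summit.BirchSwinnertonDyer.Rank1Residual.O5.T36
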